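import Summits.BirchSwinnertonDyer.Rank1Residual.X11b.AnticyclotomicSelmerDual
import Summits.BirchSwinnertonDyer.Rank1Residual.X11b.BDPRouteLinks
import Summits.BirchSwinnertonDyer.Rank1Residual.X11b.CastellaErratumThm11Skeleton
import Literature.NumberTheory.EllipticCurves.IwasawaAnticyclotomicProofs
import Literature.NumberTheory.NumberFields.CongruenceSubgroupTorsionFree
import HarnessLib

/-!
# X11b, routes R1 and p2 — the `Λ`-adic links with their ALGEBRAIC side on the constructed module
# `X_ac(E[p^∞])`; erratum Thm. 1.1 / Cas18 Thm. 2.3 (torsion clauses) typed on a real object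

HONEST FRAMING (cell `b2b-bsdres`, run/shared/lean/b2b/bsd-rank1-residual/, verbatim in every
file): the goal of the cell is to DELETE the COMBINATION-SHAPED residual classes of the
Birch–Swinnerton-Dyer formula for ALL analytic-rank `≤ 1` elliptic curves over `ℚ` — "full BSD
formula for every rank `≤ 1` curve in class `C`" assembled STRICTLY from published theorems — so
that the rank-`≤ 1` remainder becomes exactly the CONSTRUCTION-SHAPED classes, which are TYPED
(missing-input `Prop`s), NOT attempted. This is not "finishing BSD". Sub-cell
`b2b-bsdres-multr1-p1` (X11b, route R1); a RESEARCH ROUTE; no claim beyond the stated class; X11b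
stays CONSTRUCTION-SHAPED; nothing here changes a label; no named fact is minted (`Prop`-valued
predicates with parameters naming published / open SHAPES, and proved bookkeeping theorems; every
result consuming an open shape is CONDITIONAL; no `sorry`).

## What changes with respect to `CastellaErratumLinks.lean` (gen 1) and `BDPRouteLinks.lean`

There the four `Λ`-adic links behind Castella's display (5.3) — (IMC) erratum Thm. 1.1 at the
trivial character [OPEN], (BDP) Cas18 Thm. 3.2 [PUB], (CTL) Cas18 Thm. 2.3 [PUB], (TAM-q) [PUB,
elementary] — are predicates on a SHADOW `LambdaAdicShadow W K P = (ord_p f_ac(0), ord_p L_p(f)(𝟙),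
ord_p log_ω P, ord_p ∏_{w∣N⁺} c_w)`, four integers pinned by docstrings only, because neither
`X_ac(E[p^∞])` nor `L_p(f)` existed in the tree. `AnticyclotomicSelmer(Dual).lean` (this gen) NOW
CONSTRUCT Castella's `Sel_𝔭(K_∞, E[p^∞])` (Cas18 Def. 2.2, `K_∞`-formulation) and its `Λ`-dual
`X_ac(E[p^∞])` with its `Λ = ℤ_p⟦T⟧`-module structure and characteristic ideal. This file re-types
the two links that mention `f_ac` — (IMC) and (CTL) — with their algebraic side ON THAT MODULE:

* `LambdaAdicShadow.IMCAtTrivialCharReal S p κ 𝔭 γ` — **(IMC@𝟙)ʳ, OPEN** (route R1): "`X_ac(E[p^∞])`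
  (for the `ℤ_p`-extension `κ`, generator `γ`, distinguished prime `𝔭`) is `Λ`-torsion, its
  characteristic ideal has a generator `f` with `f(0) ≠ 0`, and `ord_p f(0) = ord_p L_p(f)(𝟙)`" —
  the shadow's field `charValOrd` is no longer read: the number `ord_p f_ac(0)` is supplied by the
  module (`AcSelmer.XAc.HasCharValuationAt`, well defined by `.unique`).
* `LambdaAdicShadow.IMCLowerAtTrivialCharReal` — **(IMC≥@𝟙)ʳ, OPEN** (route p2's one-sided input
  STEP L, JSW17 §7.4.1 shape): `ord_p L_p(f)(𝟙) ≤ ord_p f(0)` for such a generator.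
* `LambdaAdicShadow.ControlAtReal` — **(CTL)ʳ, PUB shape** (Cas18 Thm. 2.3, `Σ = ∅`, `p ∣ N`):
  `ord_p f(0) = ord_p #Ш(E/K)[p^∞] + 2·((ord_p log_ω P − 1) − ord_p [E(K):ℤP]) + ord_p ∏_{w∣N⁺} c_w`
  for such a generator — left side on the module, `Ш`, index on tree objects, `log_ω P` and the
  `N⁺`-Tamagawa valuation still the shadow's.
* **`display53At_of_realLinks`** / **`indexLowerBoundAt_of_realLinks`**: (IMC@𝟙)ʳ ∘ (BDP) ∘ (CTL)ʳ ∘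
  (TAM-q) ⟹ Castella's display (5.3) (route R1's per-datum open input `Display53At`), resp.
  (IMC≥@𝟙)ʳ ∘ … ⟹ STEP L (`IndexLowerBoundAt`, route p2). NEW CONTENT of the gluing: in gen 1 the two
  links (IMC) and (CTL) referred to "the same" `ord_p f_ac(0)` by naming convention (one shadow
  field); here each produces its own witness `n`, `n'` for the SAME MODULE and
  `XAc.HasCharValuationAt.unique` (generator independence of `ord_p f(0)`, a theorem) identifies them.
* `shadow_of_realLinks`: the real links recover a gen-1 shadow satisfying the gen-1 predicates
  (compatibility with every consumer of `CastellaErratumLinks` / `BDPRouteLinks`).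
* CLASS-LEVEL typed statements WITHOUT any shadow, on the constructed module:
  `Thm11TorsionRealAt W p K` — erratum Thm. 1.1, FIRST CLAUSE ("`X_ac(E[p^∞])` is `Λ`-torsion")
  under its printed hypotheses `Thm11Hypotheses W p K`, for every anticyclotomic `ℤ_p`-extension,
  generator and prime `𝔭 ∣ p` [OPEN, `[claim: …, under-review]`]; `ControlTorsionAt W p K` — Cas18
  Thm. 2.3, FIRST CLAUSE (same conclusion under `rank_ℤ E(K) = 1`, `#Ш(E/K)[p^∞] < ∞` and §2.1's
  standing hypotheses: `E` semistable, `p ≥ 5`, `E[p]` irreducible, `K` imaginary quadratic, `p`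
  split) [PUB shape, CJM 6 (2018) Thm. 2.3 ⇐ JSW17 Thm. 3.3.1]; `thm11TorsionRealAt_of_controlTorsionAt`:
  on a SEMISTABLE curve of rank one over `K` with finite `Ш(E/K)[p^∞]` the torsion clause of the
  unrefereed Thm. 1.1 is already the published Thm. 2.3 — the OPEN content of Thm. 1.1 there is the
  characteristic-ideal identity alone; `exists_anticyclotomic_generator_prime`: the quantifier
  domain (κ, γ, 𝔭) of these statements is non-empty for imaginary quadratic `K` (tree: global
  reciprocity ⇒ anticyclotomic `ℤ_p`-extension; surjectivity of `κ`; a prime of `𝓞_K` above `p`).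

What stays a shadow: `ord_p L_p(f)(𝟙)` (Castella's BDP-type `p`-adic `L`-function at `p ∣ N`, Cas18
Thm. 3.1 — the analytic half of the CONSTRUCTION-shaped residue of X11b), `ord_p log_{ω_E} P` (the
tree has `padicLogPoint` over `ℚ_p` but not yet the transport `E(K) → E(K_𝔭) = E(ℚ_p)`), and
`ord_p ∏_{w ∣ N⁺} c_w(E/K)`. Labels unchanged; nothing booked.

References: [Castella2018] Def. 2.2, Thm. 2.3, Thm. 3.2, §5 (5.1)–(5.3) (arXiv:1704.06608 pp. 5, 9,
12); [Castella2018Erratum] Thm. 1.1 (p. 1); [JetchevSkinnerWan2017] Thm. 3.3.1, §7.4.1;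
[GreenbergLNM1716] §1.
-/

noncomputable section

open scoped Classical

open WeierstrassCurve NumberField IsDedekindDomain Literature.NumberTheory.EllipticCurves
  Literature.NumberTheory.EllipticCurves.Rank1Residual Literature.RingTheory.FittingIdeal
  Summit.BirchSwinnertonDyer.Rank1Residual.X11b.AcSelmer

namespace Summit.BirchSwinnertonDyer.Rank1Residual.X11b

/-! ### The two `f_ac`-links with their algebraic side on `X_ac(E[p^∞])` -/

section Links

variable {W : WeierstrassCurve ℚ} {K : Type} [Field K] [NumberField K]
  {P : (W.baseChange K).toAffine.Point}
variable (p : ℕ) [Fact p.Prime] (κ : ZpExtension K p) (𝔭 : HeightOneSpectrum (𝓞 K))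
  (γ : Field.absoluteGaloisGroup K) [Fact (κ.IsTopGenerator γ)]

/-- **(IMC@𝟙)ʳ — OPEN, algebraic side real: erratum Thm. 1.1 at the trivial character for the
constructed `X_ac(E[p^∞])`.** "`Ch_Λ(X_ac(E[p^∞]))` is `Λ`-torsion and `Ch_Λ(X_ac(E[p^∞]))Λ_{R₀} =
(L_p(f))`" (erratum p. 1), evaluated at `𝟙`: the `Λ = ℤ_p⟦T⟧`-module `X_ac(E[p^∞]) =
AcSelmer.XAc (E_K) p κ 𝔭 ∅ γ` (dual of Castella's `Sel_𝔭(K_∞, E[p^∞])` for the `ℤ_p`-extension `κ`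
— intended: THE anticyclotomic one — with `T = γ − 1`) is `Λ`-torsion, `Ch_Λ` has a generator `f`
with `f(0) ≠ 0`, and `ord_p f(0) = ord_p L_p(f)(𝟙)` (the shadow's `lpTrivOrd`; `L_p(f)` itself, Cas18
Thm. 3.1 at `p ∣ N`, is NOT constructed). The shadow field `charValOrd` is not read. UNREFEREED (web
erratum; proof via Fouquet–Wan arXiv:2107.13726 Thm. 4.41). THE isolated open link of route R1 in
its finest typed form. A predicate; NEVER a theorem. [claim: Castella2018Erratum, status: under-review] -/
def LambdaAdicShadow.IMCAtTrivialCharReal (S : LambdaAdicShadow W K P) : Prop :=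
  ∃ n : ℕ, XAc.HasCharValuationAt (W.baseChange K) p κ 𝔭 ∅ γ n ∧ (n : ℤ) = S.lpTrivOrd

/-- **(IMC≥@𝟙)ʳ — OPEN, algebraic side real: the one-sided divisibility at the trivial character for
the constructed `X_ac(E[p^∞])`** (route p2's input; `BDPRouteLinks`): `X_ac` is `Λ`-torsion, `Ch_Λ`
has a generator `f` with `f(0) ≠ 0`, and `ord_p L_p(f)(𝟙) ≤ ord_p f(0)`. At `p ∥ N` its only source
is the erratum's (2.4) "By [FW21, Thm. 4.41]". A predicate; NEVER a theorem.
[claim: Castella2018Erratum, status: under-review] -/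
def LambdaAdicShadow.IMCLowerAtTrivialCharReal (S : LambdaAdicShadow W K P) : Prop :=
  ∃ n : ℕ, XAc.HasCharValuationAt (W.baseChange K) p κ 𝔭 ∅ γ n ∧ S.lpTrivOrd ≤ (n : ℤ)

/-- **(CTL)ʳ — PUB shape, algebraic side real: Cas18 Thm. 2.3 (anticyclotomic control), `p ∣ N`,
`Σ = ∅`, at the point `P`, for the constructed `X_ac(E[p^∞])`** (Camb. J. Math. 6 (2018) §2.2, from
JSW17 Thm. 3.3.1; not touched by the erratum): "`X_ac(E[p^∞])` is `Λ`-torsion, and letting `f_ac(T)`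
be a generator of `Ch_Λ(X_ac(E[p^∞]))`, `#ℤ_p/f_ac(0) = #Ш(E/K)[p^∞]·(#ℤ_p/((1 − a_p p⁻¹ + ε_p)
log_{ω_E} P)/[E(K) ⊗ ℤ_p : ℤ_p.P])² × ∏_{w∣N⁺} c_w^{(p)}(E/K)`", `ε_p = 0` at `p ∣ N`, in valuations
(`ord_p((1 − a_p p⁻¹) log_ω P) = logOrd − 1` at a multiplicative `p`): the module is torsion with a
generator `f`, `f(0) ≠ 0`, and `ord_p f(0) = ord_p #Ш(E/K)[p^∞] + 2·((logOrd − 1) − ord_p[E(K):ℤP]) +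
tamSplitOrd`. `Ш(E/K)[p^∞]` and the index are tree objects; `logOrd`, `tamSplitOrd` are the shadow's.
Printed hypotheses (`rank_ℤ E(K) = 1`, `#Ш(E/K)[p^∞] < ∞`, §2.1 standing: semistable, `p ≥ 5`,
irreducible, `p` split) are carried by the consumer. A predicate; nothing asserted.
[cite: Castella2018, Thm. 2.3 (arXiv:1704.06608 p. 5) (shape only; nothing asserted)] -/
def LambdaAdicShadow.ControlAtReal (S : LambdaAdicShadow W K P) : Prop :=
  ∃ n : ℕ, XAc.HasCharValuationAt (W.baseChange K) p κ 𝔭 ∅ γ n ∧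
    (n : ℤ) = (padicValNat p (Nat.card (AddCommGroup.primaryComponent (W.baseChange K).sha p)) : ℤ) +
      2 * ((S.logOrd - 1) - (padicValNat p (AddSubgroup.zmultiples P).index : ℤ)) + S.tamSplitOrd

variable {p κ 𝔭 γ}

/-- Route R1's real link implies route p2's (equality gives the inequality). [folklore] -/
theorem LambdaAdicShadow.imcLowerAtTrivialCharReal_of_imcAtTrivialCharReal (S : LambdaAdicShadow W K P)
    (h : S.IMCAtTrivialCharReal p κ 𝔭 γ) : S.IMCLowerAtTrivialCharReal p κ 𝔭 γ := by
  obtain ⟨n, hn, he⟩ := h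
  exact ⟨n, hn, le_of_eq he.symm⟩

/-- **The real links recover a gen-1 shadow satisfying the gen-1 predicates.** From (IMC@𝟙)ʳ and
(CTL)ʳ (two witnesses `n`, `n'` for the same module, identified by `XAc.HasCharValuationAt.unique`)
the shadow `⟨n, lpTrivOrd, logOrd, tamSplitOrd⟩` satisfies `IMCAtTrivialChar` and `ControlAt`, and
inherits (BDP), (TAM-q) — so every consumer of `CastellaErratumLinks`/`BDPRouteLinks` applies.
[cite: Castella2018, §5 (5.1)–(5.3) (arXiv:1704.06608 p. 12)] -/
theorem LambdaAdicShadow.shadow_of_realLinks (S : LambdaAdicShadow W K P)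
    (hIMC : S.IMCAtTrivialCharReal p κ 𝔭 γ) (hBDP : S.WaldspurgerAt) (hCTL : S.ControlAtReal p κ 𝔭 γ)
    (hTAM : S.TamagawaAtRamifiedAt p) :
    ∃ S' : LambdaAdicShadow W K P, XAc.HasCharValuationAt (W.baseChange K) p κ 𝔭 ∅ γ S'.charValOrd.toNat ∧
      S'.lpTrivOrd = S.lpTrivOrd ∧ S'.logOrd = S.logOrd ∧ S'.tamSplitOrd = S.tamSplitOrd ∧
      S'.IMCAtTrivialChar ∧ S'.WaldspurgerAt ∧ S'.ControlAt p ∧ S'.TamagawaAtRamifiedAt p := by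
  obtain ⟨n, hn, hne⟩ := hIMC
  obtain ⟨n', hn', hne'⟩ := hCTL
  obtain rfl : n = n' := hn.unique hn'
  exact ⟨⟨n, S.lpTrivOrd, S.logOrd, S.tamSplitOrd⟩, by simpa using hn, rfl, rfl, rfl, hne, hBDP, hne',
    hTAM⟩

/-- **Castella's display (5.3) from the real links**: (IMC@𝟙)ʳ [OPEN] ∘ (BDP) ∘ (CTL)ʳ ∘ (TAM-q)
[PUB shapes] ⟹ `Display53At W p K P` — route R1's per-datum open input with its algebraic side on
the constructed `X_ac(E[p^∞])`. The two `f_ac`-witnesses are identified by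
`XAc.HasCharValuationAt.unique`; then the gen-1 bookkeeping `display53At_of_shadowLinks` applies.
CONDITIONAL on (IMC@𝟙)ʳ. [cite: Castella2018, §5 (5.1)–(5.3) (arXiv:1704.06608 p. 12)]
[cite: Castella2018Erratum, Thm. 1.1 (p. 1)] -/
theorem display53At_of_realLinks [W.IsGloballyMinimal] (S : LambdaAdicShadow W K P)
    (hIMC : S.IMCAtTrivialCharReal p κ 𝔭 γ) (hBDP : S.WaldspurgerAt) (hCTL : S.ControlAtReal p κ 𝔭 γ)
    (hTAM : S.TamagawaAtRamifiedAt p) : Display53At W p K P := by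
  obtain ⟨S', -, -, -, -, h1, h2, h3, h4⟩ := S.shadow_of_realLinks hIMC hBDP hCTL hTAM
  exact display53At_of_shadowLinks p S' h1 h2 h3 h4

/-- **STEP L from the real links** (route p2): (IMC≥@𝟙)ʳ [OPEN] ∘ (BDP) ∘ (CTL)ʳ ∘ (TAM-q) [PUB
shapes], with `Ш(E/K)` finite and the Tamagawa transport value, ⟹ `IndexLowerBoundAt W p K P`. As
`indexLowerBoundAt_of_shadowLinks`, the two `f_ac`-witnesses identified by
`XAc.HasCharValuationAt.unique`. CONDITIONAL on (IMC≥@𝟙)ʳ.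
[cite: JetchevSkinnerWan2017, §7.4.1 (eq:shalowerK-1) (arXiv:1512.06894 p. 30)]
[cite: Castella2018, (1.1) (p. 2), Thm. 2.3, Thm. 3.2] -/
theorem indexLowerBoundAt_of_realLinks [Finite (W.baseChange K).sha] (S : LambdaAdicShadow W K P)
    (hIMC : S.IMCLowerAtTrivialCharReal p κ 𝔭 γ) (hBDP : S.WaldspurgerAt)
    (hCTL : S.ControlAtReal p κ 𝔭 γ) (hTAM : S.TamagawaAtRamifiedAt p)
    (htamK : padicValNat p (W.baseChange K).tamagawaProduct = 2 * padicValNat p W.tamagawaProduct) :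
    IndexLowerBoundAt W p K P := by
  obtain ⟨n, hn, hle⟩ := hIMC
  obtain ⟨n', hn', hne'⟩ := hCTL
  obtain rfl : n = n' := hn.unique hn'
  exact indexLowerBoundAt_of_shadowLinks p ⟨n, S.lpTrivOrd, S.logOrd, S.tamSplitOrd⟩ hle hBDP hne' hTAM
    htamK

/-- Conversely, granted (CTL)ʳ, the display (5.3) FORCES (IMC@𝟙)ʳ whenever (BDP) and (TAM-q) hold:
on the published links the open content of route R1 at a datum is exactly "`ord_p f(0) =
ord_p L_p(f)(𝟙)` for a generator `f` of `Ch_Λ` of the constructed `X_ac`", no more. Bookkeeping.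
[folklore] -/
theorem LambdaAdicShadow.imcAtTrivialCharReal_iff_display53At [W.IsGloballyMinimal]
    (S : LambdaAdicShadow W K P) (hBDP : S.WaldspurgerAt) (hCTL : S.ControlAtReal p κ 𝔭 γ)
    (hTAM : S.TamagawaAtRamifiedAt p) :
    S.IMCAtTrivialCharReal p κ 𝔭 γ ↔ Display53At W p K P := by
  refine ⟨fun h ↦ display53At_of_realLinks S h hBDP hCTL hTAM, fun h ↦ ?_⟩
  obtain ⟨n, hn, hne⟩ := hCTL
  refine ⟨n, hn, ?_⟩
  have := (imcAtTrivialChar_iff_display53At p ⟨n, S.lpTrivOrd, S.logOrd, S.tamSplitOrd⟩ hBDP hne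
    hTAM).2 h
  exact this

end Links

/-! ### Erratum Thm. 1.1 ⇐ Thm. 2.3 (printed inputs) INSTANTIATED on the constructed `X_ac(E[p^∞])` -/

section Skeleton

variable {K : Type} [Field K] [NumberField K] (W : WeierstrassCurve K) (p : ℕ) [Fact p.Prime]
  (κ : ZpExtension K p) (𝔭 : HeightOneSpectrum (𝓞 K)) (S : Set (HeightOneSpectrum (𝓞 K)))
  (γ : Field.absoluteGaloisGroup K) [Fact (κ.IsTopGenerator γ)]

/-- **Erratum Thm. 1.1 for `Σ`, kernel form, ON THE CONSTRUCTED MODULE.** The commutative algebra of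
erratum p. 4 (`CongruenceLimit.iwasawaAlgebra_isTorsion_and_charIdeal_eq_of_congruences_printed`,
gens 3–5, proved for an abstract finite `Λ`-module `M`) instantiated with `M := X_ac^Σ(E[p^∞]) =
AcSelmer.XAc W p κ 𝔭 S γ`: GIVEN that `X_ac^Σ(E[p^∞])` is finitely generated over `Λ` (`hfg`; "easily
shown", Cas18 §2.1 — NOT proved here), `L ≠ 0` (`L^Σ_p(f)`; Cornut–Vatsal / [Cas20, Thm. 5.3] +
(BDP)), and for each `m ≥ 1` a finite `Λ`-module `N_m` (`X^Σ_ac(A_{g_m})`, abstract here) and `L_m`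
(`L^Σ_p(g_m)`) with `e` [(b) + Lemma 2.1, dualised: `X_ac^Σ(E)/p^m ≅ N_m/p^m`], `hT`, `hCh` [Thm. 2.3
for `g_m` ⇐ FW21 Thm. 4.41, PREPRINT], `hnf` [Lemma 2.2 for `g_m`], `hc` [(c), Cas20 Thm. 2.11]:
**`X_ac^Σ(E[p^∞])` is `Λ`-torsion and `Ch_Λ(X_ac^Σ(E[p^∞])) = Fitt_Λ = (L)`** — the conclusion of
Thm. 1.1 (over `Λ`; ring bookkeeping to `Λ_{R₀}` as in `CongruenceLimitBaseChange`) as a statement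
ABOUT `E`, no longer about an abstract `M`. CONDITIONAL on the displayed inputs; deletes nothing.
[cite: Castella2018Erratum, Thm. 1.1 and proof (pp. 1, 4)] [cite: Skinner2016PacificMC, §3.1 (p. 192)] -/
theorem AcSelmer.XAc.isTorsion_and_charIdeal_eq_of_congruences_printed
    (hfg : Module.Finite (IwasawaAlgebra p) (XAc W p κ 𝔭 S γ))
    (N : ℕ → Type) [∀ m, AddCommGroup (N m)] [∀ m, Module (IwasawaAlgebra p) (N m)]
    [∀ m, Module.Finite (IwasawaAlgebra p) (N m)]
    {L : IwasawaAlgebra p} (hL : L ≠ 0) (Lm : ℕ → IwasawaAlgebra p)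
    (e : ∀ m : ℕ, 1 ≤ m →
      ((XAc W p κ 𝔭 S γ ⧸ ((Ideal.span {(PowerSeries.C (p : ℤ_[p]) : IwasawaAlgebra p)}) ^ m •
          (⊤ : Submodule (IwasawaAlgebra p) (XAc W p κ 𝔭 S γ)))) ≃ₗ[IwasawaAlgebra p]
        (N m ⧸ ((Ideal.span {(PowerSeries.C (p : ℤ_[p]) : IwasawaAlgebra p)}) ^ m •
          (⊤ : Submodule (IwasawaAlgebra p) (N m))))))
    (hT : ∀ m : ℕ, 1 ≤ m → Module.IsTorsion (IwasawaAlgebra p) (N m))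
    (hCh : ∀ m : ℕ, 1 ≤ m → Module.charIdeal (IwasawaAlgebra p) (N m) = Ideal.span {Lm m})
    (hnf : ∀ m : ℕ, 1 ≤ m → ∀ N' : Submodule (IwasawaAlgebra p) (N m),
      Module.length (IwasawaAlgebra p) N' ≠ ⊤ → N' = ⊥)
    (hc : ∀ m : ℕ, 1 ≤ m →
      Ideal.span {Lm m} ⊔ (Ideal.span {(PowerSeries.C (p : ℤ_[p]) : IwasawaAlgebra p)}) ^ m =
        Ideal.span {L} ⊔ (Ideal.span {(PowerSeries.C (p : ℤ_[p]) : IwasawaAlgebra p)}) ^ m) :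
    Module.IsTorsion (IwasawaAlgebra p) (XAc W p κ 𝔭 S γ) ∧
      Module.fittingIdeal (IwasawaAlgebra p) (XAc W p κ 𝔭 S γ) 0 = Ideal.span {L} ∧
      XAc.charIdeal W p κ 𝔭 S γ = Ideal.span {L} := by
  haveI := hfg
  exact CongruenceLimit.iwasawaAlgebra_isTorsion_and_charIdeal_eq_of_congruences_printed p N hL Lm e
    hT hCh hnf hc

/-- **… hence "`ord_p f_ac^Σ(0)`" on the constructed module equals `ord_p L(0)`** whenever `L(0) ≠ 0`
(`L = L^Σ_p(f)`: `L(0) = L_p(f)(𝟙) ≠ 0` in analytic rank one by (BDP), Cas18 Thm. 3.2): the shape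
`XAc.HasCharValuationAt … (ord_p L(0))` — the algebraic side of (IMC@𝟙)ʳ — from the printed inputs of
erratum p. 4. CONDITIONAL on those inputs. [cite: Castella2018Erratum, Thm. 1.1 and proof (pp. 1, 4)]
[cite: Castella2018, §5 (5.1) (arXiv:1704.06608 p. 12)] -/
theorem AcSelmer.XAc.hasCharValuationAt_of_congruences_printed
    (hfg : Module.Finite (IwasawaAlgebra p) (XAc W p κ 𝔭 S γ))
    (N : ℕ → Type) [∀ m, AddCommGroup (N m)] [∀ m, Module (IwasawaAlgebra p) (N m)]
    [∀ m, Module.Finite (IwasawaAlgebra p) (N m)]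
    {L : IwasawaAlgebra p} (hL0 : PowerSeries.constantCoeff L ≠ 0) (Lm : ℕ → IwasawaAlgebra p)
    (e : ∀ m : ℕ, 1 ≤ m →
      ((XAc W p κ 𝔭 S γ ⧸ ((Ideal.span {(PowerSeries.C (p : ℤ_[p]) : IwasawaAlgebra p)}) ^ m •
          (⊤ : Submodule (IwasawaAlgebra p) (XAc W p κ 𝔭 S γ)))) ≃ₗ[IwasawaAlgebra p]
        (N m ⧸ ((Ideal.span {(PowerSeries.C (p : ℤ_[p]) : IwasawaAlgebra p)}) ^ m •
          (⊤ : Submodule (IwasawaAlgebra p) (N m))))))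
    (hT : ∀ m : ℕ, 1 ≤ m → Module.IsTorsion (IwasawaAlgebra p) (N m))
    (hCh : ∀ m : ℕ, 1 ≤ m → Module.charIdeal (IwasawaAlgebra p) (N m) = Ideal.span {Lm m})
    (hnf : ∀ m : ℕ, 1 ≤ m → ∀ N' : Submodule (IwasawaAlgebra p) (N m),
      Module.length (IwasawaAlgebra p) N' ≠ ⊤ → N' = ⊥)
    (hc : ∀ m : ℕ, 1 ≤ m →
      Ideal.span {Lm m} ⊔ (Ideal.span {(PowerSeries.C (p : ℤ_[p]) : IwasawaAlgebra p)}) ^ m =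
        Ideal.span {L} ⊔ (Ideal.span {(PowerSeries.C (p : ℤ_[p]) : IwasawaAlgebra p)}) ^ m) :
    XAc.HasCharValuationAt W p κ 𝔭 S γ (PowerSeries.constantCoeff L).valuation := by
  have hL : L ≠ 0 := fun h ↦ hL0 (by rw [h, map_zero])
  obtain ⟨hTor, -, hch⟩ := AcSelmer.XAc.isTorsion_and_charIdeal_eq_of_congruences_printed W p κ 𝔭 S γ
    hfg N hL Lm e hT hCh hnf hc
  exact ⟨hTor, L, hch, hL0, rfl⟩

end Skeleton

/-! ### Class-level statements on the constructed module, no shadow -/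

section ClassLevel

variable (W : WeierstrassCurve ℚ) [W.IsGloballyMinimal] (p : ℕ) [Fact p.Prime]
  (K : Type) [Field K] [NumberField K]

/-- **Erratum Thm. 1.1, first clause, ON THE CONSTRUCTED MODULE — OPEN.** Under the hypotheses of
Thm. 1.1 at `(E, p, K)` VERBATIM (`Thm11Hypotheses`: multiplicative `p > 3`, `K` imaginary quadratic
with `𝒪_K/𝔑 ≃ ℤ/N` and `p` split, (i) `E[p]` irreducible, (ii) `2` nonsplit ⇒ `2 ∥ N`, (iii) nonsplit
multiplicative reduction at the nonsplit-in-`K` primes `q ∥ N`, one of them with `E[p]` ramified,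
(iv) `E(ℚ_p)[p] = 0`): for every ANTICYCLOTOMIC `ℤ_p`-extension `κ` of `K`, every topological
generator `γ` and every prime `𝔭 ∣ p` of `K`, the `Λ`-module `X_ac(E[p^∞]) = XAc (E_K) p κ 𝔭 ∅ γ`
(dual of Castella's `Sel_𝔭(K_∞, E[p^∞])`, CONSTRUCTED in `AnticyclotomicSelmerDual`) is `Λ`-torsion
— "Then `Ch_Λ(X_ac(E[p^∞]))` is `Λ`-torsion" (erratum p. 1; the second clause, `= (L_p(f))`, has no
tree object on its right side yet). UNREFEREED. A predicate on `(W, p, K)`; NEVER a theorem; results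
using it are CONDITIONAL. [claim: Castella2018Erratum, status: under-review] -/
def Thm11TorsionRealAt : Prop :=
  Thm11Hypotheses W p K →
    ∀ (κ : ZpExtension K p), κ.IsAnticyclotomic →
      ∀ (γ : Field.absoluteGaloisGroup K) [Fact (κ.IsTopGenerator γ)] (𝔭 : HeightOneSpectrum (𝓞 K)),
        ((p : ℕ) : 𝓞 K) ∈ 𝔭.asIdeal →
          Module.IsTorsion (IwasawaAlgebra p) (XAc (W.baseChange K) p κ 𝔭 ∅ γ)

/-- **Cas18 Thm. 2.3, first clause, ON THE CONSTRUCTED MODULE — PUB shape** (Camb. J. Math. 6 (2018)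
Thm. 2.3 with `Σ = ∅`, "this follows easily from the 'Anticyclotomic Control Theorem' established in
[JSW]" = JSW17 Thm. 3.3.1; not withdrawn by the erratum): under §2.1's standing hypotheses ("`E/ℚ`
semistable … `p ≥ 5` … `ρ̄_{E,p}` irreducible … `K` an imaginary quadratic field in which `p = 𝔭𝔭̄`
splits") and "assume that `rank_ℤ(E(K)) = 1` and that `#Ш(E/K)[p^∞] < ∞`. Then `X_ac^Σ(E[p^∞])` is
`Λ`-torsion": for every anticyclotomic `κ`, generator `γ`, prime `𝔭 ∣ p`, the constructed
`X_ac(E[p^∞])` is `Λ`-torsion. (`K_∞`-formulation = Castella's `H¹(K, T ⊗ Λ^*)`-formulation by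
Shapiro's lemma, not formalised.) `ShaFinite` (all of `Ш(E/K)`) is the tree's spelling, implied by and
on the route equivalent to `#Ш(E/K)[p^∞] < ∞` given Kolyvagin. A predicate on `(W, p, K)`; nothing
asserted; NOT a named fact (it is consumed as a hypothesis).
`-- TODO(general form): JSW17 Thm. 3.3.1 without "semistable"; the Σ-imprimitive clause.`
[cite: Castella2018, Thm. 2.3 (arXiv:1704.06608 p. 5) (shape only; nothing asserted)]
[cite: JetchevSkinnerWan2017, Thm. 3.3.1 (shape only; nothing asserted)] -/
def ControlTorsionAt : Prop :=
  Semistable W → 5 ≤ p → Irr W p → IsImaginaryQuadratic K → SplitsIn K p →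
    (W.baseChange K).mordellWeilRank = 1 → (W.baseChange K).ShaFinite →
      ∀ (κ : ZpExtension K p), κ.IsAnticyclotomic →
        ∀ (γ : Field.absoluteGaloisGroup K) [Fact (κ.IsTopGenerator γ)] (𝔭 : HeightOneSpectrum (𝓞 K)),
          ((p : ℕ) : 𝓞 K) ∈ 𝔭.asIdeal →
            Module.IsTorsion (IwasawaAlgebra p) (XAc (W.baseChange K) p κ 𝔭 ∅ γ)

variable {W p K}

/-- **On a semistable curve of rank one over `K` with finite `Ш(E/K)`, the torsion clause of the
unrefereed Thm. 1.1 is already the published Thm. 2.3** (the hypotheses of Thm. 1.1 contain `p ≥ 5`,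
`E[p]` irreducible, `K` imaginary quadratic, `p` split): there the OPEN content of Thm. 1.1 is the
characteristic-ideal identity alone. Bookkeeping between the two typed shapes.
[cite: Castella2018, Thm. 2.3 (arXiv:1704.06608 p. 5)] [cite: Castella2018Erratum, Thm. 1.1 (p. 1)] -/
theorem thm11TorsionRealAt_of_controlTorsionAt (hCTL : ControlTorsionAt W p K) (hss : Semistable W)
    (hrk : (W.baseChange K).mordellWeilRank = 1) (hsha : (W.baseChange K).ShaFinite) :
    Thm11TorsionRealAt W p K := by
  intro h κ hκ γ _ 𝔭 h𝔭
  exact hCTL hss h.1 h.2.2.2.2.2.1 h.2.2.1 h.2.2.2.2.1 hrk hsha κ hκ γ 𝔭 h𝔭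

/-- **The quantifier domain of `Thm11TorsionRealAt` / `ControlTorsionAt` is non-empty**: an
imaginary quadratic `K` HAS an anticyclotomic `ℤ_p`-extension (tree theorem
`exists_anticyclotomic_holds`, from the global reciprocity law), every `ℤ_p`-extension has a
topological generator (surjectivity of `κ`), and `𝓞_K` has a prime above `p`. So the typed statements
are not vacuously satisfiable. [cite: GreenbergLNM1716, §1 (the anticyclotomic `ℤ_p`-extension)] -/
theorem exists_anticyclotomic_generator_prime (hK : IsImaginaryQuadratic K) :
    ∃ (κ : ZpExtension K p) (γ : Field.absoluteGaloisGroup K) (𝔭 : HeightOneSpectrum (𝓞 K)),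
      κ.IsAnticyclotomic ∧ κ.IsTopGenerator γ ∧ ((p : ℕ) : 𝓞 K) ∈ 𝔭.asIdeal := by
  haveI : NumberField.IsTotallyComplex K := hK.2
  obtain ⟨κ, hκ⟩ := exists_anticyclotomic_holds K p hK.1
    (fun w ↦ NumberField.IsTotallyComplex.isComplex w)
  obtain ⟨γ, hγ⟩ := κ.surjective (Multiplicative.ofAdd 1)
  obtain ⟨𝔭, h𝔭⟩ :=
    Literature.NumberTheory.NumberFields.RingOfIntegers.exists_heightOneSpectrum_natCast_mem K
      (Fact.out : p.Prime)
  exact ⟨κ, γ, 𝔭, hκ, hγ, h𝔭⟩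

omit [W.IsGloballyMinimal] in
/-- **Under `ControlTorsionAt`, an instance of the torsion conclusion EXISTS** on a semistable
rank-one pair (non-vacuity of the typed shape at the data the route uses).
[cite: Castella2018, Thm. 2.3 (arXiv:1704.06608 p. 5)] -/
theorem exists_isTorsion_of_controlTorsionAt (hCTL : ControlTorsionAt W p K) (hss : Semistable W)
    (hp : 5 ≤ p) (hirr : Irr W p) (hK : IsImaginaryQuadratic K) (hsplit : SplitsIn K p)
    (hrk : (W.baseChange K).mordellWeilRank = 1) (hsha : (W.baseChange K).ShaFinite) :
    ∃ (κ : ZpExtension K p) (γ : Field.absoluteGaloisGroup K) (𝔭 : HeightOneSpectrum (𝓞 K))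
      (hγ : κ.IsTopGenerator γ), κ.IsAnticyclotomic ∧ ((p : ℕ) : 𝓞 K) ∈ 𝔭.asIdeal ∧
        letI : Fact (κ.IsTopGenerator γ) := ⟨hγ⟩
        Module.IsTorsion (IwasawaAlgebra p) (XAc (W.baseChange K) p κ 𝔭 ∅ γ) := by
  obtain ⟨κ, γ, 𝔭, hκ, hγ, h𝔭⟩ := exists_anticyclotomic_generator_prime (p := p) hK
  haveI : Fact (κ.IsTopGenerator γ) := ⟨hγ⟩
  exact ⟨κ, γ, 𝔭, hγ, hκ, h𝔭, hCTL hss hp hirr hK hsplit hrk hsha κ hκ γ 𝔭 h𝔭⟩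

end ClassLevel

end Summit.BirchSwinnertonDyer.Rank1Residual.X11b

end
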